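import Summits.PneNP.PneNP.Theorems.SymmetryBudgetWindowBarrierEntropyGameCircuitSem
import Summits.PneNP.PneNP.Theorems.SymmetryBudgetWindowBarrierEntropyGameCircuitSymm

/-!
# Completeness of the entropy game, IV: stabilisation and the identification circuit
(dichotomy `WindowBarrier` stmt-PneNP-2145 / `NoHiddenOrder` stmt-PneNP-14781, route `PneNP/SymmetryBudget`)

* **Stabilisation** (`CosetGame.relInf_of_rel_card`): for two graphs `G`, `H` the canonical refinement
  restricted to the positions of `G` and `H` is a decreasing sequence of subsets of the finite set
  `CosetGame.St n K` of (type, position, side, position, side) data, evolving AUTONOMOUSLY (the round-`r+1`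
  relation on these data is determined by the round-`r` relation on them, `CosetGame.st_succ_congr`); so
  it is constant from some round `≤ |St|` on, and `Rel K T … G β H γ` for `T ≥ |St|` already gives `RelInf`.
* **The identification circuit** (`CosetGame.exists_identifying_circuit`): for every `K`, `n` and target
  `H` on `Fin n`, the compiled coset-refinement circuit with `T = |St n K|` rounds is a `Sym(Fin n)`-symmetric
  `tcBasis`-circuit with `Fintype.card (Node n K T)` gates accepting exactly the matrices `x` whose graph
  `Gr x` admits an entropy-`K` game with `H` (`compile_crDAG_eval_iff` + `nonempty_entropyGame_iff` +
  stabilisation).  The explicit bound `|Node n K T| ≤ 2^{c(K) n}` is the counting of types and cosets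
  (`index_blockGroup_le`), recorded in the next file.
* **Completeness for pairs** (`CosetGame.entropyGame_of_indistinguishable`): if no `Sym(Fin n)`-symmetric
  `tcBasis`-circuit with at most `|Node n K |St||` gates separates the adjacency matrices of `G` and `H`,
  then `EntropyGame K G H`.
-/

-- `Summit.PneNP.PneNP.…` duplicates `PneNP` BY DESIGN (single-problem summit).
set_option linter.dupNamespace false

namespace Summit.PneNP.PneNP.Theorems

open Finset Literature.Computability.Complexity Literature.ModelTheory.FiniteModelTheory
open scoped Classical

namespace CosetGame

variable {n K : ℕ}

noncomputable section

/-! ### Representatives -/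

/-- `Rel` at arbitrary representatives is `Rel` at the chosen representatives of their cosets. -/
theorem rel_iff_rel_out (r : ℕ) (A : Ty n K) (G : SimpleGraph (Fin n)) (β : Equiv.Perm (Fin n))
    (H : SimpleGraph (Fin n)) (γ : Equiv.Perm (Fin n)) :
    Rel K r A.1 G β H γ ↔
      Rel K r A.1 G (QuotientGroup.mk β : Cos A).out H (QuotientGroup.mk γ : Cos A).out := by
  obtain ⟨a, ha⟩ := QuotientGroup.mk_out_eq_mul A.1 β
  obtain ⟨b, hb⟩ := QuotientGroup.mk_out_eq_mul A.1 γ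
  rw [ha, hb]
  exact ((Rel.mul_mem_left (A := A.1) r a.2).trans (Rel.mul_mem_right (A := A.1) r b.2)).symm

/-! ### The state of the refinement on a pair of graphs -/

/-- The finite index set of the state: a type, and two (position, side) pairs. -/
abbrev St (n K : ℕ) : Type := Σ A : Ty n K, (Cos A × Bool) × (Cos A × Bool)

/-- The side selector. -/
def gr (G H : SimpleGraph (Fin n)) : Bool → SimpleGraph (Fin n)
  | true => G
  | false => H

/-- The state at round `r`: which (type, position-of-side, position-of-side) data are related. -/
def st (G H : SimpleGraph (Fin n)) (r : ℕ) (s : St n K) : Prop :=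
  Rel K r s.1.1 (gr G H s.2.1.2) s.2.1.1.out (gr G H s.2.2.2) s.2.2.1.out

/-- The state is antitone in the round. -/
theorem st_anti (G H : SimpleGraph (Fin n)) {r : ℕ} {s : St n K} (h : st G H (r + 1) s) : st G H r s :=
  Rel.of_succ h

/-- **Autonomy**: if the states at rounds `r` and `r'` agree, so do the states at rounds `r + 1` and
`r' + 1` (the successor clause only consults the previous round on the same pair of graphs, at
positions, by `rel_iff_rel_out`). -/
theorem st_succ_congr (G H : SimpleGraph (Fin n)) {r r' : ℕ} (h : ∀ s : St n K, st G H r s ↔ st G H r' s)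
    (s : St n K) : st G H (r + 1) s ↔ st G H (r' + 1) s := by
  obtain ⟨A, ⟨P, b⟩, ⟨Q, c⟩⟩ := s
  unfold st
  simp only
  rw [Rel.succ_iff, Rel.succ_iff]
  have hr : ∀ (B : Ty n K) (β γ : Equiv.Perm (Fin n)) (b' c' : Bool),
      Rel K r B.1 (gr G H b') β (gr G H c') γ ↔ Rel K r' B.1 (gr G H b') β (gr G H c') γ := by
    intro B β γ b' c'
    rw [rel_iff_rel_out r B, rel_iff_rel_out r' B]
    exact h ⟨B, ⟨QuotientGroup.mk β, b'⟩, ⟨QuotientGroup.mk γ, c'⟩⟩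
  refine and_congr (hr A _ _ b c) (and_congr ?_ Iff.rfl)
  refine forall_congr' fun B => forall_congr' fun hB => ?_
  refine exists_congr fun e => forall_congr' fun ρ => ?_
  exact hr ⟨B, hB⟩ _ _ b c

/-- Equal states propagate to all later rounds. -/
theorem st_congr_add (G H : SimpleGraph (Fin n)) {r : ℕ} (h : ∀ s : St n K, st G H (r + 1) s ↔ st G H r s) :
    ∀ (k : ℕ) (s : St n K), st G H (r + k) s ↔ st G H r s := by
  intro k
  induction k with
  | zero => intro s; exact Iff.rfl
  | succ k ih =>
    intro s
    rw [← add_assoc]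
    exact (st_succ_congr G H ih s).trans (h s)

/-- **Stabilisation**: some round `r ≤ |St|` has the same state as its successor. -/
theorem exists_stable_round (G H : SimpleGraph (Fin n)) :
    ∃ r ≤ Fintype.card (St n K), ∀ s : St n K, st G H (r + 1) s ↔ st G H r s := by
  set c : ℕ → ℕ := fun r => (univ.filter fun s : St n K => st G H r s).card with hc
  have hsub : ∀ r, (univ.filter fun s : St n K => st G H (r + 1) s) ⊆ univ.filter fun s : St n K => st G H r s :=
    fun r s hs => by
      simp only [mem_filter, mem_univ, true_and] at hs ⊢
      exact st_anti G H hs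
  have hanti : ∀ r, c (r + 1) ≤ c r := fun r => Finset.card_le_card (hsub r)
  have hc0 : c 0 ≤ Fintype.card (St n K) := (Finset.card_filter_le _ _).trans (Finset.card_univ (α := St n K)).le
  by_contra hne
  have hne' : ∀ r ≤ Fintype.card (St n K), ¬ ∀ s : St n K, st G H (r + 1) s ↔ st G H r s :=
    fun r hr hiff => hne ⟨r, hr, hiff⟩
  have hlt : ∀ r ≤ Fintype.card (St n K), c (r + 1) < c r := by
    intro r hr
    refine lt_of_le_of_ne (hanti r) fun heq => ?_
    have hseq := Finset.eq_of_subset_of_card_le (hsub r) heq.ge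
    refine hne' r hr fun s => ?_
    have := congrArg (fun t => s ∈ t) hseq
    simp only [mem_filter, mem_univ, true_and] at this
    exact Iff.of_eq this
  have key : ∀ r ≤ Fintype.card (St n K) + 1, c r + r ≤ c 0 := by
    intro r
    induction r with
    | zero => intro _; simp
    | succ r ih =>
      intro hr
      have h1 := ih (by omega)
      have h2 := hlt r (by omega)
      omega
  have := key (Fintype.card (St n K) + 1) le_rfl
  omega

/-- **Late rounds are the limit**: if `T ≥ |St n K|` then `Rel K T A G β H γ` implies `RelInf K A G β H γ`. -/
theorem relInf_of_rel_card {T : ℕ} (hT : Fintype.card (St n K) ≤ T) (A : Ty n K) (G H : SimpleGraph (Fin n))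
    (β γ : Equiv.Perm (Fin n)) (h : Rel K T A.1 G β H γ) : RelInf K A.1 G β H γ := by
  obtain ⟨r₀, hr₀, hstab⟩ := exists_stable_round (K := K) G H
  have hall := st_congr_add G H hstab
  -- the datum of `(A, β, G-side, γ, H-side)`
  let s : St n K := ⟨A, ⟨QuotientGroup.mk β, true⟩, ⟨QuotientGroup.mk γ, false⟩⟩
  have hs : ∀ r, st G H r s ↔ Rel K r A.1 G β H γ := fun r => (rel_iff_rel_out r A G β H γ).symm
  have hT' : st G H T s := (hs T).2 h
  have hr₀T : st G H r₀ s := by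
    obtain ⟨k, rfl⟩ := Nat.exists_eq_add_of_le (hr₀.trans hT)
    exact (hall k s).1 hT'
  intro r
  rcases le_or_gt r T with hle | hgt
  · exact Rel.anti hle h
  · obtain ⟨k, rfl⟩ := Nat.exists_eq_add_of_le (show r₀ ≤ r by omega)
    exact (hs _).1 ((hall k s).2 hr₀T)

/-! ### The identification circuit -/

/-- The number of rounds used: the size of the state set. -/
abbrev rounds (n K : ℕ) : ℕ := Fintype.card (St n K)

/-- **The coset-refinement circuit identifies the entropy-`K` class of its target.**  For every target
`H` on `Fin n`, the compiled circuit with `rounds n K` rounds is a `Sym(Fin n)`-symmetric circuit over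
`tcBasis` with `Fintype.card (Node n K (rounds n K))` gates which accepts an input matrix `x` iff the
graph `Gr x = SimpleGraph.fromRel (x (·,·) = true)` admits an entropy-`K` game with `H`. -/
theorem exists_identifying_circuit (K : ℕ) (H : SimpleGraph (Fin n)) :
    ∃ C : Circuit (Fin n × Fin n), C.IsOver tcBasis ∧ C.IsSymmetricUnder Set.univ ∧
      C.size = Fintype.card (Node n K (rounds n K)) ∧
      ∀ x : Fin n × Fin n → Bool, C.eval x = true ↔
        Nonempty (EntropyGame K (SimpleGraph.fromRel fun a b : Fin n => x (a, b) = true) H) := by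
  refine ⟨(crDAG K (rounds n K) H).compile, compile_crDAG_isOver H, compile_crDAG_isSymmetricUnder H,
    by rw [Circuit.size, GateDAG.compile_gates_length], fun x => ?_⟩
  rw [compile_crDAG_eval_iff, nonempty_entropyGame_iff]
  constructor
  · rintro ⟨β, γ, h⟩
    exact ⟨β, γ, relInf_of_rel_card le_rfl (ty₀ n K) _ _ β γ h⟩
  · rintro ⟨β, γ, h⟩
    exact ⟨β, γ, h _⟩

/-- The adjacency input of `G` reads back `G`. -/
theorem fromRel_adjInput' (G : SimpleGraph (Fin n)) :
    (SimpleGraph.fromRel fun a b : Fin n => adjInput G (a, b) = true) = G := fromRel_adjInput G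

/-- **Completeness for pairs**: if no `Sym(Fin n)`-symmetric `tcBasis`-circuit with at most
`Fintype.card (Node n K (rounds n K))` gates separates the adjacency matrices of `G` and `H`, then
`G` and `H` admit an entropy-`K` game.  (Apply the identification circuit of `H`: it accepts `H`, by the
game `EntropyGame.ofIso`, hence accepts `G`.) -/
theorem entropyGame_of_indistinguishable (K : ℕ) (G H : SimpleGraph (Fin n))
    (h : ∀ C : Circuit (Fin n × Fin n), C.IsOver tcBasis → C.IsSymmetricUnder Set.univ →
      C.size ≤ Fintype.card (Node n K (rounds n K)) → C.eval (adjInput G) = C.eval (adjInput H)) :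
    Nonempty (EntropyGame K G H) := by
  obtain ⟨C, hB, hsym, hsize, hC⟩ := exists_identifying_circuit K H
  have hH : C.eval (adjInput H) = true := by
    rw [hC, fromRel_adjInput']
    exact ⟨EntropyGame.ofIso K SimpleGraph.Iso.refl⟩
  have hG : C.eval (adjInput G) = true := by rw [h C hB hsym hsize.le]; exact hH
  rw [hC, fromRel_adjInput'] at hG
  exact hG

end

end CosetGame

end Summit.PneNP.PneNP.Theorems
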